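import Mathlib
import HarnessLib
import Literature.Analysis.FluidPDE.ClassicalSolution
import Literature.Analysis.FluidPDE.TaoLocalisation
import Literature.Analysis.FluidPDE.TaoEnstrophyLocalisationProofs
import Literature.Analysis.FluidPDE.NSWeakStrongUniquenessProofs
import Literature.Analysis.FluidPDE.WholeSpaceIBP
import Summits.NavierStokesRegularity.NavierStokesRegularity.Theses.StretchingWellBinding

/-!
# Shelf 1574: the quarter law forces VOLUME SPARSENESS of the fast set at every threshold

Helper file (`--supports stmt-NavierStokesRegularity-1574 --as helper`). Sobolev–Chebyshev converse of the
`lamb_budget` decomposition of the shelf crux (`Cruxes/EnstrophyQuarterLaw/Lines/lamb_budget.lean`, ns-idea-9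
g3, LINE 7: `EnstrophyQuarterLaw ⟺ 0056 ∧ VolumeSparsenessLaw`): for ONE classical Leray–Hopf solution the
slice quarter law `∫ |curl u(s)|² ≤ K/√(T−s)` forces, at EVERY threshold `c₀ > 0`, that the FAST SET
`F_{c₀}(s) = {x : |u(s,x)| > c₀ √(ν/(T−s))}` has Lebesgue measure `≤ N (√(ν(T−s)))³` — it occupies
boundedly many parabolic cells — with `N = C_S⁶ K³ c₀⁻⁶ ν^{-9/2}` (`C_S` = Mathlib's Sobolev constant of
`H¹(ℝ³) ⊂ L⁶`). PROOF: Chebyshev at the level `λ = c₀√(ν/(T−s))` in `L⁶`, the whole-space Sobolev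
inequality for `H¹` fields (`eLpNorm_six_le_frobenius_of_hasWeakGradient`) and the div–curl estimate
`∫ |∇u|² ≤ ∫ |curl u|²` (`lintegral_frobeniusNormSq_fderiv_le_lintegral_sq_norm_curl`).

* `volume_fastSet_le_of_slice` — the per-slice estimate with the explicit constant (`C_S` = Mathlib's
  `SNormLESNormFDerivOfEqConst`);
* `volumeSparseOfSlice` — the statement `VolumeSparseOfSlice` of `Lines/lamb_budget.lean` with its
  Cruxes-local predicates (`SliceLaw`, `VolumeSparse`, `fastSet`) UNFOLDED VERBATIM (= the signature of the
  line's `stub_volumeSparseOfSlice`, "provable, S/M");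
* `volumeSparse_of_enstrophyQuarterLaw` — BY NAME from the crux: `EnstrophyQuarterLaw →` volume sparseness
  at every threshold of every first blow-up (the line's "Converse 1" with its stub discharged).

HONEST FRAMING: conditional bookkeeping about ONE hypothetical blow-up; `EnstrophyQuarterLaw` (1574) and
`VolumeSparsenessLaw` stay OPEN; nothing here bears on the regularity problem itself. No summit statement is
proved.
-/

noncomputable section

-- the summit-side namespace repeats a component by design (D-0017)
set_option linter.dupNamespace false

namespace Summit.NavierStokesRegularity.NavierStokesRegularity.Theorems.EnstrophyQuarterLaw.LambBudget

open Set MeasureTheory Function Metric Filter Topology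
open scoped ENNReal NNReal
open Literature.Analysis.FluidPDE

variable {ν T : ℝ} {u : ℝ → EuclideanSpace ℝ (Fin 3) → EuclideanSpace ℝ (Fin 3)}
  {p : ℝ → EuclideanSpace ℝ (Fin 3) → ℝ}

/-- **Slice quarter law ⇒ the fast set is volume sparse, one slice.** For a classical solution on `[0, T)`
(`ν > 0`), Leray–Hopf on `[0, T]`, with `∫ |curl u(s)|² ≤ K/√(T − s)` at some `s ∈ [0, T)` (`K ≥ 0`), and any
threshold `c₀ > 0`: `|{x : c₀√(ν/(T−s)) < |u(s,x)|}| ≤ (C_S⁶ K³ / (c₀⁶ (√ν)⁹)) · (√(ν(T−s)))³`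
(Chebyshev in `L⁶` at the level `c₀√(ν/(T−s))`, Sobolev `H¹ ⊂ L⁶`, `∫|∇u(s)|² ≤ ∫|curl u(s)|²`). [folklore] -/
theorem volume_fastSet_le_of_slice (hν : 0 < ν)
    (hsol : IsClassicalNSSolutionOn (Ico 0 T) ν 0 u p) (hLH : IsLerayHopfOn T ν 0 (u 0) u)
    {K : ℝ} (hK : 0 ≤ K) {s : ℝ} (hs : s ∈ Ico 0 T)
    (hslice : ∫⁻ x, ‖curl (u s) x‖ₑ ^ 2 ≤ ENNReal.ofReal (K / Real.sqrt (T - s)))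
    {c₀ : ℝ} (hc₀ : 0 < c₀) :
    volume {x : EuclideanSpace ℝ (Fin 3) | c₀ * Real.sqrt (ν / (T - s)) < ‖u s x‖} ≤
      ENNReal.ofReal (((SNormLESNormFDerivOfEqConst (EuclideanSpace ℝ (Fin 3))
          (volume : Measure (EuclideanSpace ℝ (Fin 3))) 2 : ℝ≥0) : ℝ) ^ 6 * K ^ 3 /
          (c₀ ^ 6 * Real.sqrt ν ^ 9) * Real.sqrt (ν * (T - s)) ^ 3) := by
  -- the Sobolev constant of `H¹(ℝ³) ⊂ L⁶`
  set CS : ℝ≥0 := SNormLESNormFDerivOfEqConst (EuclideanSpace ℝ (Fin 3))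
    (volume : Measure (EuclideanSpace ℝ (Fin 3))) 2 with hCS
  have hτ : 0 < T - s := sub_pos.2 hs.2
  set a : ℝ := Real.sqrt ν with ha
  set b : ℝ := Real.sqrt (T - s) with hb
  have hapos : 0 < a := Real.sqrt_pos.2 hν
  have hbpos : 0 < b := Real.sqrt_pos.2 hτ
  -- the level
  set lam : ℝ := c₀ * Real.sqrt (ν / (T - s)) with hlam
  have hlam_eq : lam = c₀ * a / b := by
    rw [hlam, Real.sqrt_div hν.le, ha, hb]; ring
  have hlampos : 0 < lam := by rw [hlam_eq]; positivity
  -- the slice: `C¹`, in `L²`, with `∫ |∇u(s)|² ≤ K / b`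
  have hC2 : ContDiff ℝ 2 (u s) := (hsol.contDiff_velocity hs).of_le (by norm_cast)
  have hC1 : ContDiff ℝ 1 (u s) := hC2.of_le (by norm_cast)
  have hmem : MemLp (u s) 2 volume := hLH.memLp s ⟨hs.1, hs.2.le⟩
  have hL2 : ∫⁻ x, ‖u s x‖ₑ ^ 2 < ⊤ :=
    lt_of_le_of_lt (hLH.lintegral_enorm_sq_le hν.le ⟨hs.1, hs.2.le⟩) ENNReal.ofReal_lt_top
  set D : ℝ≥0∞ := ∫⁻ x, ENNReal.ofReal (frobeniusNormSq (fderiv ℝ (u s) x)) with hD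
  have hDle : D ≤ ENNReal.ofReal (K / b) :=
    (lintegral_frobeniusNormSq_fderiv_le_lintegral_sq_norm_curl hC2 (hsol.divFree s hs) hL2).trans hslice
  -- Sobolev
  have h6 : eLpNorm (u s) 6 volume ≤ (CS : ℝ≥0∞) * D ^ (1 / 2 : ℝ) :=
    eLpNorm_six_le_frobenius_of_hasWeakGradient finrank_euclideanSpace_fin hmem
      (hasWeakGradient_fderiv_of_contDiff hC1)
  have h6' : eLpNorm (u s) 6 volume ^ (6 : ℝ) ≤ ENNReal.ofReal ((CS : ℝ) ^ 6 * (K / b) ^ 3) := by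
    calc eLpNorm (u s) 6 volume ^ (6 : ℝ)
        ≤ ((CS : ℝ≥0∞) * D ^ (1 / 2 : ℝ)) ^ (6 : ℝ) := ENNReal.rpow_le_rpow h6 (by norm_num)
      _ = (CS : ℝ≥0∞) ^ (6 : ℝ) * D ^ (3 : ℝ) := by
          rw [ENNReal.mul_rpow_of_nonneg _ _ (by norm_num), ← ENNReal.rpow_mul]
          norm_num
      _ ≤ (CS : ℝ≥0∞) ^ (6 : ℝ) * ENNReal.ofReal (K / b) ^ (3 : ℝ) := by gcongr
      _ = ENNReal.ofReal ((CS : ℝ) ^ 6 * (K / b) ^ 3) := by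
          rw [show ((CS : ℝ≥0) : ℝ≥0∞) = ENNReal.ofReal (CS : ℝ) from (ENNReal.ofReal_coe_nnreal).symm,
            ENNReal.ofReal_rpow_of_nonneg (by positivity) (by norm_num),
            ENNReal.ofReal_rpow_of_nonneg (by positivity) (by norm_num),
            ← ENNReal.ofReal_mul (by positivity)]
          congr 1
          rw [show (6 : ℝ) = ((6 : ℕ) : ℝ) by norm_num, show (3 : ℝ) = ((3 : ℕ) : ℝ) by norm_num,
            Real.rpow_natCast, Real.rpow_natCast]
  -- Chebyshev at the level `lam` in `L⁶`
  have hmeas : AEStronglyMeasurable (u s) volume := hC1.continuous.aestronglyMeasurable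
  have hsub : {x : EuclideanSpace ℝ (Fin 3) | c₀ * Real.sqrt (ν / (T - s)) < ‖u s x‖} ⊆
      {x | ENNReal.ofReal lam ≤ ‖u s x‖ₑ} := by
    intro x hx
    have hx' : lam < ‖u s x‖ := hx
    rw [mem_setOf_eq, ← ofReal_norm]
    exact ENNReal.ofReal_le_ofReal hx'.le
  have hcheb := meas_ge_le_mul_pow_eLpNorm_enorm volume (p := (6 : ℝ≥0∞)) (by norm_num) (by norm_num)
    hmeas (ENNReal.ofReal_pos.2 hlampos).ne' (fun h => absurd h ENNReal.ofReal_ne_top)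
  have h6r : ((6 : ℝ≥0∞)).toReal = (6 : ℝ) := by norm_num
  rw [h6r] at hcheb
  calc volume {x : EuclideanSpace ℝ (Fin 3) | c₀ * Real.sqrt (ν / (T - s)) < ‖u s x‖}
      ≤ volume {x | ENNReal.ofReal lam ≤ ‖u s x‖ₑ} := measure_mono hsub
    _ ≤ (ENNReal.ofReal lam)⁻¹ ^ (6 : ℝ) * eLpNorm (u s) 6 volume ^ (6 : ℝ) := hcheb
    _ ≤ (ENNReal.ofReal lam)⁻¹ ^ (6 : ℝ) * ENNReal.ofReal ((CS : ℝ) ^ 6 * (K / b) ^ 3) := by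
        gcongr
    _ = ENNReal.ofReal (lam⁻¹ ^ 6 * ((CS : ℝ) ^ 6 * (K / b) ^ 3)) := by
        rw [← ENNReal.ofReal_inv_of_pos hlampos,
          ENNReal.ofReal_rpow_of_nonneg (by positivity) (by norm_num),
          show (6 : ℝ) = ((6 : ℕ) : ℝ) by norm_num, Real.rpow_natCast,
          ← ENNReal.ofReal_mul (by positivity)]
    _ = ENNReal.ofReal ((CS : ℝ) ^ 6 * K ^ 3 / (c₀ ^ 6 * Real.sqrt ν ^ 9) *
          Real.sqrt (ν * (T - s)) ^ 3) := by
        congr 1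
        rw [hlam_eq, Real.sqrt_mul hν.le, ← ha, ← hb]
        field_simp

/-- **`VolumeSparseOfSlice` of `Lines/lamb_budget.lean`** (the signature of the line's
`stub_volumeSparseOfSlice`, its Cruxes-local predicates `SliceLaw`, `VolumeSparse`, `fastSet` UNFOLDED
VERBATIM): for every threshold `c₀ > 0`, the slice quarter law of a maximal classical Leray–Hopf solution
from a rapidly decaying datum forces volume sparseness of the fast set, `|F_{c₀}(s)| ≤ N (√(ν(T−s)))³` on
`[0, T)`, with `N = C_S⁶ (max K 0)³ c₀⁻⁶ (√ν)⁻⁹`. [folklore] -/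
theorem volumeSparseOfSlice :
    ∀ c₀ : ℝ, 0 < c₀ →
    ∀ (ν T : ℝ), 0 < ν → 0 < T →
      ∀ (u : ℝ → EuclideanSpace ℝ (Fin 3) → EuclideanSpace ℝ (Fin 3))
        (p : ℝ → EuclideanSpace ℝ (Fin 3) → ℝ),
      IsMaximalSmoothSolution ν 0 u p T → IsLerayHopfOn T ν 0 (u 0) u → HasRapidSpatialDecay (u 0) →
      (∃ K : ℝ, ∀ t ∈ Set.Ico 0 T,
        ∫⁻ x, ‖curl (u t) x‖ₑ ^ 2 ≤ ENNReal.ofReal (K / Real.sqrt (T - t))) →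
      ∃ N : ℝ, ∀ s ∈ Set.Ico 0 T,
        volume {x : EuclideanSpace ℝ (Fin 3) | c₀ * Real.sqrt (ν / (T - s)) < ‖u s x‖} ≤
          ENNReal.ofReal (N * Real.sqrt (ν * (T - s)) ^ 3) := by
  intro c₀ hc₀ ν T hν _hT u p hmax hLH _hdec hslice
  obtain ⟨K, hK⟩ := hslice
  set K' : ℝ := max K 0 with hK'
  have hK'0 : 0 ≤ K' := le_max_right _ _
  have hK'slice : ∀ t ∈ Ico 0 T,
      ∫⁻ x, ‖curl (u t) x‖ₑ ^ 2 ≤ ENNReal.ofReal (K' / Real.sqrt (T - t)) :=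
    fun t ht => (hK t ht).trans
      (ENNReal.ofReal_le_ofReal (div_le_div_of_nonneg_right (le_max_left _ _) (Real.sqrt_nonneg _)))
  exact ⟨((SNormLESNormFDerivOfEqConst (EuclideanSpace ℝ (Fin 3))
      (volume : Measure (EuclideanSpace ℝ (Fin 3))) 2 : ℝ≥0) : ℝ) ^ 6 * K' ^ 3 /
      (c₀ ^ 6 * Real.sqrt ν ^ 9), fun s hs =>
    volume_fastSet_le_of_slice hν hmax.1 hLH hK'0 hs (hK'slice s hs) hc₀⟩

/-- **`EnstrophyQuarterLaw ⇒` volume sparseness of the fast set at EVERY threshold** — the line's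
"Converse 1" (`volumeSparse_of_enstrophyQuarterLaw` of `Lines/lamb_budget.lean`) with its stub
`stub_volumeSparseOfSlice` discharged: at every first blow-up of a classical Leray–Hopf solution from a
rapidly decaying datum, for every `c₀ > 0`, `|{|u(s)| > c₀√(ν/(T−s))}| ≤ N (√(ν(T−s)))³` on `[0, T)`. So the
NEW crux `B` (`VolumeSparsenessLaw`) is a CONSEQUENCE of the shelf crux. Conditional edge between OPEN
statements only. [folklore] -/
theorem volumeSparse_of_enstrophyQuarterLaw
    (hQ : Summit.NavierStokesRegularity.NavierStokesRegularity.Theses.StretchingWellBinding.EnstrophyQuarterLaw)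
    {c₀ : ℝ} (hc₀ : 0 < c₀) :
    ∀ (ν T : ℝ), 0 < ν → 0 < T →
      ∀ (u : ℝ → EuclideanSpace ℝ (Fin 3) → EuclideanSpace ℝ (Fin 3))
        (p : ℝ → EuclideanSpace ℝ (Fin 3) → ℝ),
      IsMaximalSmoothSolution ν 0 u p T → IsLerayHopfOn T ν 0 (u 0) u → HasRapidSpatialDecay (u 0) →
      ∃ N : ℝ, ∀ s ∈ Set.Ico 0 T,
        volume {x : EuclideanSpace ℝ (Fin 3) | c₀ * Real.sqrt (ν / (T - s)) < ‖u s x‖} ≤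
          ENNReal.ofReal (N * Real.sqrt (ν * (T - s)) ^ 3) :=
  fun ν T hν hT u p hmax hLH hdec =>
    volumeSparseOfSlice c₀ hc₀ ν T hν hT u p hmax hLH hdec (hQ ν T hν hT u p hmax hLH hdec)

end Summit.NavierStokesRegularity.NavierStokesRegularity.Theorems.EnstrophyQuarterLaw.LambBudget

end
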